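import Literature.Geometry.Kaehler.ComplexTorusHodgeGroupProductLieKernels
import Literature.Geometry.Kaehler.ComplexTorusHodgeGroupProductLiePerfectSolvable
import Literature.Algebra.Lie.ReductiveQuotientCenter
import HarnessLib

/-!
# Transfer along a product with FINITE KERNEL `K₁`: `Lie Hg(X₁)(ℂ)` is a quotient of `Lie Hg(X₂)(ℂ)`, so `X₁` inherits from
# `X₂` abelianness (`Hg` commutative, CM type), solvability, perfectness, semisimplicity, reductivity and the bound on the centre

Layer `Literature/Geometry/Kaehler`, namespace `Literature.Geometry.Kaehler.ComplexTorus`; lane `lit-hodgefound` (Track 2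
foundations library), Layer A3/A4; prover seat `lit-hodgefound-p17` (generation 41, self-proposed row g41-#11), consumer of
`ComplexTorusHodgeGroupProductLieKernels` (g41-#5: `K₁` finite ⟹ `Lie Hg(X₂)(ℂ) ↠ Lie Hg(X₁)(ℂ)`,
`exists_surjective_lieHom_of_finite_hodgeGroupCProdInl`) through the tree's transfer lemmas for surjective homomorphisms of Lie
algebras (`Function.Surjective.isLieAbelian`, `Function.Surjective.lieAlgebra_isSolvable`,
`GoursatPerfectSolvable.derivedSeries_one_eq_top_of_surjective`, `isSemisimple_of_surjective`, `hasTrivialRadical_of_surjective`,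
`hasCentralRadical_of_surjective`, `ReductiveQuotientCenter.finrank_center_le_of_surjective`).  THEOREMS ONLY (no definition, no
instance, no notation, no named fact; D-0026 net debt 0).

DICTIONARY.  `G = Hg(X₁ × X₂)(ℂ)`, `Gᵢ = Hg(Xᵢ)(ℂ)`, `Lie Gᵢ = lieSubalgebraGL (Gᵢ.map toGL)` (`= hodgeGroupComplexLie Xᵢ`);
`K₁ = hodgeGroupCProdInl = {s | (s 0; 0 1) ∈ G}`.  `K₁` finite is Moonen–Zarhin's `𝔤₁ = 0`: then `𝔥𝔤(X₁) ≅ 𝔤₃` is a quotient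
(for reductive `𝔥𝔤(X₂)` a direct factor) of `𝔥𝔤(X₂) ≅ 𝔤₂ ⊕ 𝔤₃` — the mechanism of their Lemmas (3.4), (3.6), (3.7).

## Sources, verbatim

* B. Moonen, Yu. G. Zarhin [MoonenZarhin1999LowDim], Math. Ann. 315 (1999), held `paper:arxiv-math_9901113`: §3 (3.1) (p0006
  L25–L45): "`𝔥𝔤(X₁) ≅ 𝔤₁ ⊕ 𝔤₃`, `𝔥𝔤(X₂) ≅ 𝔤₂ ⊕ 𝔤₃`, and `𝔥𝔤(X₁ × X₂) ≅ 𝔤₁ ⊕ 𝔤₂ ⊕ Γ_φ`"; Lemma (3.4), proof (p0006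
  L139–p0007 L1): "the assumption that `𝔥𝔤(X₂)` is `ℚ`-simple implies that `𝔥𝔤(X) = 𝔤₁ ⊕ 𝔤₃ ≅ 𝔥𝔤(X₁)` and `𝔥𝔤(X₂) ≅ 𝔤₃`";
  Lemma (3.6) (p0007 L16–L28): "Assume that the Hodge group `Hg(X₂)` is a `ℚ`-simple algebraic torus. (In particular `X₂` is of
  CM-type.) […] then the center of `Hg(X₁)` contains an algebraic torus which is `ℚ`-isogenous to `Hg(X₂)`"; §1: "`X` is of
  CM-type […] iff `Hg(X)` is a torus".
* B. B. Gordon [Gordon1997], held `paper:arxiv-alg-geom_9709030`, §2.16 Proposition (Goursat's Lemma) (p0012 L112–L119); §2.12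
  Proposition ("of CM-type if and only if `Hg(A)` is an algebraic torus").
* N. Bourbaki [Bourbaki1989LieGroups13], Ch. I §6 no. 2 Lemma 1 and Cor. 2 of Prop. 2 (p0106, p0108) (homomorphic images of
  semisimple algebras; `f(𝔯) = 𝔯'`), no. 4 Cor. (c) of Prop. 5 (p0112 L15–L19) (quotients of reductive algebras).

## What is proved (`K₁` finite unless stated; mirrors for `K₂` finite)

* §1 ALGEBRAIC (`lieSubalgebraGL`): **`isLieAbelian_of_finite_hodgeGroupCProdInl`**, **`hodgeGroup_comm_of_finite_hodgeGroupCProdInl`**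
  (`Hg(X₂)` commutative ⟹ `Hg(X₁)` commutative), `hodgeGroupC_comm_…`, `isSolvable_…`, `derivedSeries_eq_top_…` (perfect),
  **`isSemisimple_of_finite_hodgeGroupCProdInl`**, `hasTrivialRadical_…`, **`hasCentralRadical_of_finite_hodgeGroupCProdInl`**
  (reductive), **`finrank_center_le_of_finite_hodgeGroupCProdInl`** (`dim 𝔷(Lie Hg(X₁)(ℂ)) ≤ dim 𝔷(Lie Hg(X₂)(ℂ))` for reductive
  `Lie Hg(X₂)(ℂ)`), `center_eq_bot_of_finite_hodgeGroupCProdInl`; mirrors `…_of_finite_hodgeGroupCProdInr`.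
* §2 ANALYTIC (`hodgeGroupComplexLie`) and POLARISED: `isLieAbelian_hodgeGroupComplexLie_of_finite_…`,
  `isSemisimple_hodgeGroupComplexLie_of_finite_…`, **`IsRiemannForm.hasCentralRadical_hodgeGroupComplexLie_of_finite_hodgeGroupCProdInl`**
  (`X₂` polarised, `K₁` finite ⟹ `𝔥𝔤_ℂ(X₁)` reductive — no polarisation of `X₁` needed),
  `IsRiemannForm.finrank_center_hodgeGroupComplexLie_le_of_finite_…`.
* §3 ABELIAN VARIETIES: **`IsAbelianVariety.isCMType_of_finite_hodgeGroupCProdInl`** (`X₂` of CM type and `K₁` finite ⟹ `X₁` of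
  CM type; Moonen–Zarhin (3.6) "(In particular `X₂` is of CM-type)" read backwards along `𝔥𝔤(X₁) ≅ 𝔤₃ ↞ 𝔥𝔤(X₂)`).

## References

* [MoonenZarhin1999LowDim] B. Moonen, Yu. G. Zarhin, Math. Ann. 315 (1999), §1, §3 (3.1), (3.4), (3.6).
* [Gordon1997] B. B. Gordon, *A survey of the Hodge conjecture for abelian varieties*, §2.12, §2.16.
* [Bourbaki1989LieGroups13] N. Bourbaki, *Lie Groups and Lie Algebras, Chapters 1–3*, Ch. I §6 no. 2, no. 4.
-/

noncomputable section

open Matrix Module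

namespace Literature.Geometry.Kaehler

namespace ComplexTorus

open Literature.NumberTheory.Automorphic (IsAlgebraicSubgroup IsZConnected identityComponent isZConnected_identityComponent
  lieAlgebraGL lieSubalgebraGL)
open Literature.Algebra.Lie

variable {ι₁ ι₂ : Type*} [Fintype ι₁] [Fintype ι₂] [DecidableEq ι₁] [DecidableEq ι₂]
  {E₁ E₂ : Type*} [NormedAddCommGroup E₁] [NormedSpace ℂ E₁] [NormedAddCommGroup E₂] [NormedSpace ℂ E₂]
  (Φ₁ : (ι₁ → ℝ) ≃L[ℝ] E₁) (Φ₂ : (ι₂ → ℝ) ≃L[ℝ] E₂)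

/-- Finite-dimensionality of `Lie Hg(X)(ℂ)` (Springer 4.4.6). [folklore] -/
private theorem moduleFinite_lieSubalgebraGL_hodgeGroupC {ι : Type*} [Fintype ι] [DecidableEq ι] {E : Type*}
    [NormedAddCommGroup E] [NormedSpace ℂ E] (Φ : (ι → ℝ) ≃L[ℝ] E) :
    Module.Finite ℂ (lieSubalgebraGL ((hodgeGroupC Φ).map Matrix.SpecialLinearGroup.toGL)) :=
  (isZConnected_map_toGL_hodgeGroupC Φ).finrank_lieAlgebraGL_eq.1

/-! ### §1 Algebraic transfer along `Lie Hg(X₂)(ℂ) ↠ Lie Hg(X₁)(ℂ)` (`K₁` finite) -/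

/-- **`K₁` finite and `Lie Hg(X₂)(ℂ)` abelian ⟹ `Lie Hg(X₁)(ℂ)` abelian.** [cite: MoonenZarhin1999LowDim, §3 (3.1) and Lemma (3.6) (p0007 L16–L28)]
[cite: Gordon1997, §2.16 Proposition] -/
theorem isLieAbelian_of_finite_hodgeGroupCProdInl
    [h₂ : IsLieAbelian (lieSubalgebraGL ((hodgeGroupC Φ₂).map Matrix.SpecialLinearGroup.toGL))]
    (h : ((hodgeGroupCProdInl Φ₁ Φ₂ : Subgroup (SpecialLinearGroup ι₁ ℂ)) : Set (SpecialLinearGroup ι₁ ℂ)).Finite) :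
    IsLieAbelian (lieSubalgebraGL ((hodgeGroupC Φ₁).map Matrix.SpecialLinearGroup.toGL)) := by
  obtain ⟨φ, hφ⟩ := exists_surjective_lieHom_of_finite_hodgeGroupCProdInl Φ₁ Φ₂ h
  exact hφ.isLieAbelian h₂

/-- Mirror: `K₂` finite and `Lie Hg(X₁)(ℂ)` abelian ⟹ `Lie Hg(X₂)(ℂ)` abelian. [cite: MoonenZarhin1999LowDim, §3 (3.1) and Lemma (3.6)] -/
theorem isLieAbelian_of_finite_hodgeGroupCProdInr
    [h₁ : IsLieAbelian (lieSubalgebraGL ((hodgeGroupC Φ₁).map Matrix.SpecialLinearGroup.toGL))]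
    (h : ((hodgeGroupCProdInr Φ₁ Φ₂ : Subgroup (SpecialLinearGroup ι₂ ℂ)) : Set (SpecialLinearGroup ι₂ ℂ)).Finite) :
    IsLieAbelian (lieSubalgebraGL ((hodgeGroupC Φ₂).map Matrix.SpecialLinearGroup.toGL)) := by
  obtain ⟨φ, hφ⟩ := exists_surjective_lieHom_of_finite_hodgeGroupCProdInr Φ₁ Φ₂ h
  exact hφ.isLieAbelian h₁

/-- **`K₁` FINITE AND `Hg(X₂)` COMMUTATIVE ⟹ `Hg(X₁)` COMMUTATIVE** (real points; "`X₂` of CM-type" transfers along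
`𝔥𝔤(X₂) ↠ 𝔤₃ ≅ 𝔥𝔤(X₁)`). [cite: MoonenZarhin1999LowDim, §1 and §3 Lemma (3.6) (p0007 L16–L28)] [cite: Gordon1997, §2.12 and §2.16] -/
theorem hodgeGroup_comm_of_finite_hodgeGroupCProdInl (h₂ : ∀ M ∈ hodgeGroup Φ₂, ∀ N ∈ hodgeGroup Φ₂, M * N = N * M)
    (h : ((hodgeGroupCProdInl Φ₁ Φ₂ : Subgroup (SpecialLinearGroup ι₁ ℂ)) : Set (SpecialLinearGroup ι₁ ℂ)).Finite) :
    ∀ M ∈ hodgeGroup Φ₁, ∀ N ∈ hodgeGroup Φ₁, M * N = N * M := by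
  haveI := (isLieAbelian_lieSubalgebraGL_hodgeGroupC_iff_hodgeGroup_comm Φ₂).2 h₂
  exact (isLieAbelian_lieSubalgebraGL_hodgeGroupC_iff_hodgeGroup_comm Φ₁).1
    (isLieAbelian_of_finite_hodgeGroupCProdInl Φ₁ Φ₂ h)

/-- Complex points: `K₁` finite and `Hg(X₂)(ℂ)` commutative ⟹ `Hg(X₁)(ℂ)` commutative. [cite: MoonenZarhin1999LowDim, §3 Lemma (3.6)]
[cite: Gordon1997, §2.16 Proposition] -/
theorem hodgeGroupC_comm_of_finite_hodgeGroupCProdInl (h₂ : ∀ M ∈ hodgeGroupC Φ₂, ∀ N ∈ hodgeGroupC Φ₂, M * N = N * M)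
    (h : ((hodgeGroupCProdInl Φ₁ Φ₂ : Subgroup (SpecialLinearGroup ι₁ ℂ)) : Set (SpecialLinearGroup ι₁ ℂ)).Finite) :
    ∀ M ∈ hodgeGroupC Φ₁, ∀ N ∈ hodgeGroupC Φ₁, M * N = N * M := by
  haveI := (isLieAbelian_lieSubalgebraGL_hodgeGroupC_iff_hodgeGroupC_comm Φ₂).2 h₂
  exact (isLieAbelian_lieSubalgebraGL_hodgeGroupC_iff_hodgeGroupC_comm Φ₁).1
    (isLieAbelian_of_finite_hodgeGroupCProdInl Φ₁ Φ₂ h)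

/-- Mirror: `K₂` finite and `Hg(X₁)` commutative ⟹ `Hg(X₂)` commutative. [cite: MoonenZarhin1999LowDim, §3 Lemma (3.6)] [cite: Gordon1997, §2.16 Proposition] -/
theorem hodgeGroup_comm_of_finite_hodgeGroupCProdInr (h₁ : ∀ M ∈ hodgeGroup Φ₁, ∀ N ∈ hodgeGroup Φ₁, M * N = N * M)
    (h : ((hodgeGroupCProdInr Φ₁ Φ₂ : Subgroup (SpecialLinearGroup ι₂ ℂ)) : Set (SpecialLinearGroup ι₂ ℂ)).Finite) :
    ∀ M ∈ hodgeGroup Φ₂, ∀ N ∈ hodgeGroup Φ₂, M * N = N * M := by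
  haveI := (isLieAbelian_lieSubalgebraGL_hodgeGroupC_iff_hodgeGroup_comm Φ₁).2 h₁
  exact (isLieAbelian_lieSubalgebraGL_hodgeGroupC_iff_hodgeGroup_comm Φ₂).1
    (isLieAbelian_of_finite_hodgeGroupCProdInr Φ₁ Φ₂ h)

/-- `K₁` finite and `Lie Hg(X₂)(ℂ)` solvable ⟹ `Lie Hg(X₁)(ℂ)` solvable. [cite: MoonenZarhin1999LowDim, §3 (3.1)] [cite: Gordon1997, §2.16 Proposition] -/
theorem isSolvable_of_finite_hodgeGroupCProdInl
    [LieAlgebra.IsSolvable (lieSubalgebraGL ((hodgeGroupC Φ₂).map Matrix.SpecialLinearGroup.toGL))]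
    (h : ((hodgeGroupCProdInl Φ₁ Φ₂ : Subgroup (SpecialLinearGroup ι₁ ℂ)) : Set (SpecialLinearGroup ι₁ ℂ)).Finite) :
    LieAlgebra.IsSolvable (lieSubalgebraGL ((hodgeGroupC Φ₁).map Matrix.SpecialLinearGroup.toGL)) := by
  obtain ⟨φ, hφ⟩ := exists_surjective_lieHom_of_finite_hodgeGroupCProdInl Φ₁ Φ₂ h
  exact hφ.lieAlgebra_isSolvable

/-- `K₁` finite and `Lie Hg(X₂)(ℂ)` perfect ⟹ `Lie Hg(X₁)(ℂ)` perfect. [cite: MoonenZarhin1999LowDim, §3 (3.1)] [cite: Gordon1997, §2.16 Proposition] -/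
theorem derivedSeries_eq_top_of_finite_hodgeGroupCProdInl
    (h₂ : LieAlgebra.derivedSeries ℂ (lieSubalgebraGL ((hodgeGroupC Φ₂).map Matrix.SpecialLinearGroup.toGL)) 1 = ⊤)
    (h : ((hodgeGroupCProdInl Φ₁ Φ₂ : Subgroup (SpecialLinearGroup ι₁ ℂ)) : Set (SpecialLinearGroup ι₁ ℂ)).Finite) :
    LieAlgebra.derivedSeries ℂ (lieSubalgebraGL ((hodgeGroupC Φ₁).map Matrix.SpecialLinearGroup.toGL)) 1 = ⊤ := by
  obtain ⟨φ, hφ⟩ := exists_surjective_lieHom_of_finite_hodgeGroupCProdInl Φ₁ Φ₂ h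
  exact GoursatPerfectSolvable.derivedSeries_one_eq_top_of_surjective hφ h₂

/-- **`K₁` FINITE AND `Lie Hg(X₂)(ℂ)` SEMISIMPLE ⟹ `Lie Hg(X₁)(ℂ)` SEMISIMPLE** (homomorphic images of semisimple Lie algebras).
[cite: MoonenZarhin1999LowDim, §3 (3.1) and Lemma (3.4) proof (p0006 L139–p0007 L1)] [cite: Bourbaki1989LieGroups13, Ch. I §6 no. 2 Lemma 1 (p0106)] -/
theorem isSemisimple_of_finite_hodgeGroupCProdInl
    [LieAlgebra.IsSemisimple ℂ (lieSubalgebraGL ((hodgeGroupC Φ₂).map Matrix.SpecialLinearGroup.toGL))]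
    (h : ((hodgeGroupCProdInl Φ₁ Φ₂ : Subgroup (SpecialLinearGroup ι₁ ℂ)) : Set (SpecialLinearGroup ι₁ ℂ)).Finite) :
    LieAlgebra.IsSemisimple ℂ (lieSubalgebraGL ((hodgeGroupC Φ₁).map Matrix.SpecialLinearGroup.toGL)) := by
  haveI := moduleFinite_lieSubalgebraGL_hodgeGroupC Φ₁
  haveI := moduleFinite_lieSubalgebraGL_hodgeGroupC Φ₂
  obtain ⟨φ, hφ⟩ := exists_surjective_lieHom_of_finite_hodgeGroupCProdInl Φ₁ Φ₂ h
  exact isSemisimple_of_surjective φ hφ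

/-- Mirror: `K₂` finite and `Lie Hg(X₁)(ℂ)` semisimple ⟹ `Lie Hg(X₂)(ℂ)` semisimple. [cite: MoonenZarhin1999LowDim, §3 (3.1)]
[cite: Bourbaki1989LieGroups13, Ch. I §6 no. 2 Lemma 1 (p0106)] -/
theorem isSemisimple_of_finite_hodgeGroupCProdInr
    [LieAlgebra.IsSemisimple ℂ (lieSubalgebraGL ((hodgeGroupC Φ₁).map Matrix.SpecialLinearGroup.toGL))]
    (h : ((hodgeGroupCProdInr Φ₁ Φ₂ : Subgroup (SpecialLinearGroup ι₂ ℂ)) : Set (SpecialLinearGroup ι₂ ℂ)).Finite) :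
    LieAlgebra.IsSemisimple ℂ (lieSubalgebraGL ((hodgeGroupC Φ₂).map Matrix.SpecialLinearGroup.toGL)) := by
  haveI := moduleFinite_lieSubalgebraGL_hodgeGroupC Φ₁
  haveI := moduleFinite_lieSubalgebraGL_hodgeGroupC Φ₂
  obtain ⟨φ, hφ⟩ := exists_surjective_lieHom_of_finite_hodgeGroupCProdInr Φ₁ Φ₂ h
  exact isSemisimple_of_surjective φ hφ

/-- `K₁` finite and `Lie Hg(X₂)(ℂ)` with trivial radical ⟹ `Lie Hg(X₁)(ℂ)` has trivial radical. [cite: Bourbaki1989LieGroups13, Ch. I §6 no. 2 Lemma 1 (p0106)]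
[cite: MoonenZarhin1999LowDim, §3 (3.1)] -/
theorem hasTrivialRadical_of_finite_hodgeGroupCProdInl
    [LieAlgebra.HasTrivialRadical ℂ (lieSubalgebraGL ((hodgeGroupC Φ₂).map Matrix.SpecialLinearGroup.toGL))]
    (h : ((hodgeGroupCProdInl Φ₁ Φ₂ : Subgroup (SpecialLinearGroup ι₁ ℂ)) : Set (SpecialLinearGroup ι₁ ℂ)).Finite) :
    LieAlgebra.HasTrivialRadical ℂ (lieSubalgebraGL ((hodgeGroupC Φ₁).map Matrix.SpecialLinearGroup.toGL)) := by
  haveI := moduleFinite_lieSubalgebraGL_hodgeGroupC Φ₁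
  haveI := moduleFinite_lieSubalgebraGL_hodgeGroupC Φ₂
  obtain ⟨φ, hφ⟩ := exists_surjective_lieHom_of_finite_hodgeGroupCProdInl Φ₁ Φ₂ h
  exact hasTrivialRadical_of_surjective φ hφ

/-- **`K₁` FINITE AND `Lie Hg(X₂)(ℂ)` REDUCTIVE ⟹ `Lie Hg(X₁)(ℂ)` REDUCTIVE** (quotients of reductive Lie algebras are reductive,
Bourbaki I §6 no. 4 Cor. (c)). [cite: Bourbaki1989LieGroups13, Ch. I §6 no. 4 Cor. (c) of Prop. 5 (p0112 L15–L19)] [cite: MoonenZarhin1999LowDim, §3 (3.1)] -/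
theorem hasCentralRadical_of_finite_hodgeGroupCProdInl
    [LieAlgebra.HasCentralRadical ℂ (lieSubalgebraGL ((hodgeGroupC Φ₂).map Matrix.SpecialLinearGroup.toGL))]
    (h : ((hodgeGroupCProdInl Φ₁ Φ₂ : Subgroup (SpecialLinearGroup ι₁ ℂ)) : Set (SpecialLinearGroup ι₁ ℂ)).Finite) :
    LieAlgebra.HasCentralRadical ℂ (lieSubalgebraGL ((hodgeGroupC Φ₁).map Matrix.SpecialLinearGroup.toGL)) := by
  haveI := moduleFinite_lieSubalgebraGL_hodgeGroupC Φ₁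
  haveI := moduleFinite_lieSubalgebraGL_hodgeGroupC Φ₂
  obtain ⟨φ, hφ⟩ := exists_surjective_lieHom_of_finite_hodgeGroupCProdInl Φ₁ Φ₂ h
  exact hasCentralRadical_of_surjective φ hφ

/-- Mirror: `K₂` finite and `Lie Hg(X₁)(ℂ)` reductive ⟹ `Lie Hg(X₂)(ℂ)` reductive. [cite: Bourbaki1989LieGroups13, Ch. I §6 no. 4 Cor. (c) of Prop. 5 (p0112 L15–L19)] -/
theorem hasCentralRadical_of_finite_hodgeGroupCProdInr
    [LieAlgebra.HasCentralRadical ℂ (lieSubalgebraGL ((hodgeGroupC Φ₁).map Matrix.SpecialLinearGroup.toGL))]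
    (h : ((hodgeGroupCProdInr Φ₁ Φ₂ : Subgroup (SpecialLinearGroup ι₂ ℂ)) : Set (SpecialLinearGroup ι₂ ℂ)).Finite) :
    LieAlgebra.HasCentralRadical ℂ (lieSubalgebraGL ((hodgeGroupC Φ₂).map Matrix.SpecialLinearGroup.toGL)) := by
  haveI := moduleFinite_lieSubalgebraGL_hodgeGroupC Φ₁
  haveI := moduleFinite_lieSubalgebraGL_hodgeGroupC Φ₂
  obtain ⟨φ, hφ⟩ := exists_surjective_lieHom_of_finite_hodgeGroupCProdInr Φ₁ Φ₂ h
  exact hasCentralRadical_of_surjective φ hφ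

/-- **`K₁` finite and `Lie Hg(X₂)(ℂ)` reductive ⟹ `dim 𝔷(Lie Hg(X₁)(ℂ)) ≤ dim 𝔷(Lie Hg(X₂)(ℂ))`** (the centre of a quotient of a
reductive algebra is the image of the centre). [cite: Bourbaki1989LieGroups13, Ch. I §6 no. 4 Cor. (c) of Prop. 5 (p0112 L15–L19)]
[cite: MoonenZarhin1999LowDim, §3 Lemma (3.6) (p0007 L16–L28)] -/
theorem finrank_center_le_of_finite_hodgeGroupCProdInl
    [LieAlgebra.HasCentralRadical ℂ (lieSubalgebraGL ((hodgeGroupC Φ₂).map Matrix.SpecialLinearGroup.toGL))]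
    (h : ((hodgeGroupCProdInl Φ₁ Φ₂ : Subgroup (SpecialLinearGroup ι₁ ℂ)) : Set (SpecialLinearGroup ι₁ ℂ)).Finite) :
    Module.finrank ℂ (LieAlgebra.center ℂ (lieSubalgebraGL ((hodgeGroupC Φ₁).map Matrix.SpecialLinearGroup.toGL))) ≤
      Module.finrank ℂ (LieAlgebra.center ℂ (lieSubalgebraGL ((hodgeGroupC Φ₂).map Matrix.SpecialLinearGroup.toGL))) := by
  haveI := moduleFinite_lieSubalgebraGL_hodgeGroupC Φ₁
  haveI := moduleFinite_lieSubalgebraGL_hodgeGroupC Φ₂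
  obtain ⟨φ, hφ⟩ := exists_surjective_lieHom_of_finite_hodgeGroupCProdInl Φ₁ Φ₂ h
  exact ReductiveQuotientCenter.finrank_center_le_of_surjective hφ

/-- `K₁` finite, `Lie Hg(X₂)(ℂ)` reductive with trivial centre ⟹ `Lie Hg(X₁)(ℂ)` has trivial centre (indeed is semisimple).
[cite: Bourbaki1989LieGroups13, Ch. I §6 no. 4 Cor. (c) of Prop. 5] [cite: MoonenZarhin1999LowDim, §3 (3.1)] -/
theorem center_eq_bot_of_finite_hodgeGroupCProdInl
    [LieAlgebra.HasCentralRadical ℂ (lieSubalgebraGL ((hodgeGroupC Φ₂).map Matrix.SpecialLinearGroup.toGL))]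
    (h0 : LieAlgebra.center ℂ (lieSubalgebraGL ((hodgeGroupC Φ₂).map Matrix.SpecialLinearGroup.toGL)) = ⊥)
    (h : ((hodgeGroupCProdInl Φ₁ Φ₂ : Subgroup (SpecialLinearGroup ι₁ ℂ)) : Set (SpecialLinearGroup ι₁ ℂ)).Finite) :
    LieAlgebra.center ℂ (lieSubalgebraGL ((hodgeGroupC Φ₁).map Matrix.SpecialLinearGroup.toGL)) = ⊥ := by
  haveI : LieAlgebra.HasTrivialRadical ℂ (lieSubalgebraGL ((hodgeGroupC Φ₂).map Matrix.SpecialLinearGroup.toGL)) :=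
    ⟨by rw [LieAlgebra.HasCentralRadical.radical_eq_center, h0]⟩
  haveI := hasTrivialRadical_of_finite_hodgeGroupCProdInl Φ₁ Φ₂ h
  exact le_bot_iff.1 ((LieAlgebra.center_le_radical ℂ _).trans
    (LieAlgebra.HasTrivialRadical.radical_eq_bot (R := ℂ)
      (L := lieSubalgebraGL ((hodgeGroupC Φ₁).map Matrix.SpecialLinearGroup.toGL))).le)

/-! ### §2 Analytic (`hodgeGroupComplexLie`) and polarised forms -/

/-- `K₁` finite and `𝔥𝔤_ℂ(X₂)` abelian ⟹ `𝔥𝔤_ℂ(X₁)` abelian. [cite: MoonenZarhin1999LowDim, §3 Lemma (3.6) (p0007 L16–L28)] -/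
theorem isLieAbelian_hodgeGroupComplexLie_of_finite_hodgeGroupCProdInl [h₂ : IsLieAbelian (hodgeGroupComplexLie Φ₂)]
    (h : ((hodgeGroupCProdInl Φ₁ Φ₂ : Subgroup (SpecialLinearGroup ι₁ ℂ)) : Set (SpecialLinearGroup ι₁ ℂ)).Finite) :
    IsLieAbelian (hodgeGroupComplexLie Φ₁) := by
  rw [hodgeGroupComplexLie_eq_lieSubalgebraGL Φ₂] at h₂
  rw [hodgeGroupComplexLie_eq_lieSubalgebraGL Φ₁]
  exact isLieAbelian_of_finite_hodgeGroupCProdInl Φ₁ Φ₂ h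

/-- `K₁` finite and `𝔥𝔤_ℂ(X₂)` semisimple ⟹ `𝔥𝔤_ℂ(X₁)` semisimple. [cite: MoonenZarhin1999LowDim, §3 (3.1) and Lemma (3.4)]
[cite: Bourbaki1989LieGroups13, Ch. I §6 no. 2 Lemma 1 (p0106)] -/
theorem isSemisimple_hodgeGroupComplexLie_of_finite_hodgeGroupCProdInl
    [h₂ : LieAlgebra.IsSemisimple ℂ (hodgeGroupComplexLie Φ₂)]
    (h : ((hodgeGroupCProdInl Φ₁ Φ₂ : Subgroup (SpecialLinearGroup ι₁ ℂ)) : Set (SpecialLinearGroup ι₁ ℂ)).Finite) :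
    LieAlgebra.IsSemisimple ℂ (hodgeGroupComplexLie Φ₁) := by
  rw [hodgeGroupComplexLie_eq_lieSubalgebraGL Φ₂] at h₂
  rw [hodgeGroupComplexLie_eq_lieSubalgebraGL Φ₁]
  exact isSemisimple_of_finite_hodgeGroupCProdInl Φ₁ Φ₂ h

/-- **`X₂` POLARISED AND `K₁` FINITE ⟹ `𝔥𝔤_ℂ(X₁)` IS REDUCTIVE** — no polarisation of `X₁` is needed (`𝔥𝔤_ℂ(X₂)` is
reductive by Deligne–Milne ∕ `IsRiemannForm.hasCentralRadical_hodgeGroupComplexLie`, and `𝔥𝔤_ℂ(X₁)` is its quotient).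
[cite: Bourbaki1989LieGroups13, Ch. I §6 no. 4 Cor. (c) of Prop. 5 (p0112 L15–L19)] [cite: MoonenZarhin1999LowDim, §3 (3.1)] -/
theorem IsRiemannForm.hasCentralRadical_hodgeGroupComplexLie_of_finite_hodgeGroupCProdInl {η₂ : E₂ [⋀^Fin 2]→L[ℝ] ℝ}
    (hη₂ : IsRiemannForm Φ₂ η₂)
    (h : ((hodgeGroupCProdInl Φ₁ Φ₂ : Subgroup (SpecialLinearGroup ι₁ ℂ)) : Set (SpecialLinearGroup ι₁ ℂ)).Finite) :
    LieAlgebra.HasCentralRadical ℂ (hodgeGroupComplexLie Φ₁) := by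
  have h₂ := hη₂.hasCentralRadical_hodgeGroupComplexLie
  rw [hodgeGroupComplexLie_eq_lieSubalgebraGL Φ₂] at h₂
  rw [hodgeGroupComplexLie_eq_lieSubalgebraGL Φ₁]
  haveI := h₂
  exact hasCentralRadical_of_finite_hodgeGroupCProdInl Φ₁ Φ₂ h

/-- `X₂` polarised, `K₁` finite ⟹ `dim 𝔷(𝔥𝔤_ℂ X₁) ≤ dim 𝔷(𝔥𝔤_ℂ X₂)`. [cite: Bourbaki1989LieGroups13, Ch. I §6 no. 4 Cor. (c) of Prop. 5]
[cite: MoonenZarhin1999LowDim, §3 Lemma (3.6) (p0007 L16–L28)] -/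
theorem IsRiemannForm.finrank_center_hodgeGroupComplexLie_le_of_finite_hodgeGroupCProdInl {η₂ : E₂ [⋀^Fin 2]→L[ℝ] ℝ}
    (hη₂ : IsRiemannForm Φ₂ η₂)
    (h : ((hodgeGroupCProdInl Φ₁ Φ₂ : Subgroup (SpecialLinearGroup ι₁ ℂ)) : Set (SpecialLinearGroup ι₁ ℂ)).Finite) :
    Module.finrank ℂ (LieAlgebra.center ℂ (hodgeGroupComplexLie Φ₁)) ≤
      Module.finrank ℂ (LieAlgebra.center ℂ (hodgeGroupComplexLie Φ₂)) := by
  have h₂ := hη₂.hasCentralRadical_hodgeGroupComplexLie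
  rw [hodgeGroupComplexLie_eq_lieSubalgebraGL Φ₂] at h₂ ⊢
  rw [hodgeGroupComplexLie_eq_lieSubalgebraGL Φ₁]
  haveI := h₂
  exact finrank_center_le_of_finite_hodgeGroupCProdInl Φ₁ Φ₂ h

/-- `X₂` polarised with `𝔷(𝔥𝔤_ℂ X₂) = 0` (semisimple `𝔥𝔤`) and `K₁` finite ⟹ `𝔷(𝔥𝔤_ℂ X₁) = 0`. [cite: Bourbaki1989LieGroups13, Ch. I §6 no. 4 Cor. (c) of Prop. 5]
[cite: MoonenZarhin1999LowDim, §3 (3.1)] -/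
theorem IsRiemannForm.center_hodgeGroupComplexLie_eq_bot_of_finite_hodgeGroupCProdInl {η₂ : E₂ [⋀^Fin 2]→L[ℝ] ℝ}
    (hη₂ : IsRiemannForm Φ₂ η₂) (h0 : LieAlgebra.center ℂ (hodgeGroupComplexLie Φ₂) = ⊥)
    (h : ((hodgeGroupCProdInl Φ₁ Φ₂ : Subgroup (SpecialLinearGroup ι₁ ℂ)) : Set (SpecialLinearGroup ι₁ ℂ)).Finite) :
    LieAlgebra.center ℂ (hodgeGroupComplexLie Φ₁) = ⊥ := by
  have h₂ := hη₂.hasCentralRadical_hodgeGroupComplexLie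
  rw [hodgeGroupComplexLie_eq_lieSubalgebraGL Φ₂] at h₂ h0
  rw [hodgeGroupComplexLie_eq_lieSubalgebraGL Φ₁]
  haveI := h₂
  exact center_eq_bot_of_finite_hodgeGroupCProdInl Φ₁ Φ₂ h0 h

/-! ### §3 Abelian varieties: CM type transfers along a finite kernel -/

/-- **`X₁`, `X₂` ABELIAN VARIETIES, `X₂` OF CM TYPE AND `K₁` FINITE ⟹ `X₁` OF CM TYPE** (CM type ⟺ `(Hg, Hg) = 1` ⟺ `Hg(X)(ℂ)`
commutative ⟺ `Lie Hg(X)(ℂ)` abelian, which transfers along `Lie Hg(X₂)(ℂ) ↠ Lie Hg(X₁)(ℂ)`). [cite: MoonenZarhin1999LowDim, §1 and §3 Lemma (3.6) (p0007 L16–L28)]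
[cite: Gordon1997, §2.12 Proposition and §2.16 Proposition] -/
theorem IsAbelianVariety.isCMType_of_finite_hodgeGroupCProdInl (hX₁ : IsAbelianVariety Φ₁) (hX₂ : IsAbelianVariety Φ₂)
    (hCM₂ : ∃ T : Subalgebra ℚ (Matrix ι₂ ι₂ ℚ), T ≤ endAlgRat Φ₂ ∧ IsReduced T ∧ (∀ a ∈ T, ∀ b ∈ T, a * b = b * a) ∧
      Module.finrank ℚ T = Fintype.card ι₂)
    (h : ((hodgeGroupCProdInl Φ₁ Φ₂ : Subgroup (SpecialLinearGroup ι₁ ℂ)) : Set (SpecialLinearGroup ι₁ ℂ)).Finite) :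
    ∃ T : Subalgebra ℚ (Matrix ι₁ ι₁ ℚ), T ≤ endAlgRat Φ₁ ∧ IsReduced T ∧ (∀ a ∈ T, ∀ b ∈ T, a * b = b * a) ∧
      Module.finrank ℚ T = Fintype.card ι₁ := by
  have h₂ : ∀ M ∈ hodgeGroupC Φ₂, ∀ N ∈ hodgeGroupC Φ₂, M * N = N * M :=
    (commutator_hodgeGroupC_eq_bot_iff_forall_comm Φ₂).1 (hX₂.commutator_hodgeGroupC_eq_bot_iff.2 hCM₂)
  exact hX₁.commutator_hodgeGroupC_eq_bot_iff.1
    ((commutator_hodgeGroupC_eq_bot_iff_forall_comm Φ₁).2 (hodgeGroupC_comm_of_finite_hodgeGroupCProdInl Φ₁ Φ₂ h₂ h))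

end ComplexTorus

end Literature.Geometry.Kaehler
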